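import Summits.SmoothPoincare4.SmoothPoincare4.Theorems.ConvexBisectionAcyclicBisectionExistsPageRotationFlow
import HarnessLib

/-!
# The page-rotation isotopy: flow equation and fixed pages
(wave 3, brick T1a, part 4, of stub `stub_steinRealisation` = NF6
`Literature.Geometry.Symplectic.steinRealisation_of_sorted_modelsOnFibred`, line `modp-braid-orbits`
r11, crux `ConvexBisection.AcyclicBisectionExists`, item stmt-SmoothPoincare4-10508; registered
sub-goal `helper_rotFlow_fix`)

A complement to `helper_rotFlow_page` (`…PageRotationFlow.lean`) recording the two clauses the
letter-by-letter re-spacing of page angles (NF6 T1b) consumes besides the rotation law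
`(w ∘ R)' = a(w) · i · w`: the FLOW EQUATION of the ambient flow `θ` of the profiled field
`rotFieldA g a = a(w) · rotField g` (so that velocities of transported curves are explicit), and
**pages on which the profile vanishes do not move** (`a (w x) = 0 ⇒ R_t x = x`: zeros of the field
are fixed points of the flow, the last clause of the tree's `exists_contDiff_globalFlow`) — while
the block of pages around letter `i` is turned from `pageDir (m+n) i` to `pageDir m i` by a bump
profile, the pages of the other letters stay put.  Everything is proved; no named facts, no
`sorry`.  References: R. İ. Baykur, *Kähler decomposition of 4-manifolds*, AGT 6 (2006), proof of
Thm. 5.1 [Baykur2006]; J. M. Lee, *Introduction to Smooth Manifolds* (2012), Thm. 9.12, 9.16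
[LeeSmoothManifolds2013].
-/

noncomputable section

set_option linter.dupNamespace false

open scoped Manifold ContDiff Topology ComplexConjugate
open Set Function Metric
open Literature.Topology.FourManifolds Literature.Topology.FourManifolds.LefschetzBase

namespace Summit.SmoothPoincare4.SmoothPoincare4.Theorems.AcyclicBisectionExists.ModpBraidOrbits

variable {g : ℕ} {a : ℂ → ℝ}

/-- The profiled field vanishes where the profile does. [folklore] -/
theorem rotFieldA_eq_zero_of_apply_eq_zero {q : EuclideanSpace ℝ (Fin 4)} (hq : a (w g q) = 0) :
    rotFieldA g a q = 0 := by
  rw [rotFieldA, hq, zero_smul]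

/-- **The complete flow of the profiled rotation field, with its fixed points**: as
`exists_rotFlow`, plus: points where the profile vanishes do not move.
[cite: LeeSmoothManifolds2013, Thm. 9.16 and Thm. 9.12] -/
theorem exists_rotFlow_fix (g : ℕ) (ha : ContDiff ℝ ∞ a) :
    ∃ θ : ℝ × EuclideanSpace ℝ (Fin 4) → EuclideanSpace ℝ (Fin 4), ContDiff ℝ ∞ θ ∧
      (∀ x, θ (0, x) = x) ∧ (∀ t s x, θ (t, θ (s, x)) = θ (t + s, x)) ∧
      (∀ x t, HasDerivAt (fun t => θ (t, x)) (rotFieldA g a (θ (t, x))) t) ∧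
      ∀ x, a (w g x) = 0 → ∀ t, θ (t, x) = x := by
  obtain ⟨θ, hθ, h0, hadd, hder, hfix⟩ := Literature.Geometry.Manifold.exists_contDiff_globalFlow
    (contDiff_rotFieldA (g := g) ha) (isCompact_rho_le_two_fifths g)
    (fun x hx => rotFieldA_eq_zero_of_not_mem hx)
  exact ⟨θ, hθ, h0, hadd, hder, fun x hx => hfix x (rotFieldA_eq_zero_of_apply_eq_zero hx)⟩

/-- **(R2') The page-rotation isotopy with its flow equation and its fixed pages** (registered
sub-goal `helper_rotFlow_fix` of NF6, brick T1a): for a smooth profile `a : ℂ → ℝ`, an ambient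
isotopy `R` of `Base g`, restriction of a smooth complete flow `θ` of `ℝ⁴` whose flow lines are the
integral curves of `rotFieldA g a = a(w) · rotField g` (hence `rho`, the flat part `‖x‖² < 4` and
`‖w‖` are invariant and `(w ∘ θ)' = a(w) i w`, `…PageRotationFlow.lean` §3), and whose stages FIX
every point at which the profile vanishes: the pages outside the support of `a ∘ w` do not move.
[cite: Baykur2006, proof of Thm. 5.1, pp. 13–14] -/
theorem helper_rotFlow_fix :
    ∀ (g : ℕ) (a : ℂ → ℝ), ContDiff ℝ ∞ a →
      ∃ (R : Literature.Topology.FourManifolds.AmbientIsotopy (𝓡∂ 4)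
          (Literature.Topology.FourManifolds.LefschetzBase.Base g))
        (θ : ℝ × EuclideanSpace ℝ (Fin 4) → EuclideanSpace ℝ (Fin 4)),
        ContDiff ℝ ∞ θ ∧ (∀ x, θ (0, x) = x) ∧ (∀ t s x, θ (t, θ (s, x)) = θ (t + s, x)) ∧
        (∀ (t : ℝ) (x : Literature.Topology.FourManifolds.LefschetzBase.Base g),
          (R.toFun t x).1 = θ (t, x.1)) ∧
        (∀ x t, HasDerivAt (fun t => θ (t, x))
          (Summit.SmoothPoincare4.SmoothPoincare4.Theorems.AcyclicBisectionExists.ModpBraidOrbits.rotFieldA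
            g a (θ (t, x))) t) ∧
        (∀ t x, Literature.Topology.FourManifolds.LefschetzBase.rho g (θ (t, x)) =
          Literature.Topology.FourManifolds.LefschetzBase.rho g x) ∧
        (∀ x, a (Literature.Topology.FourManifolds.LefschetzBase.w g x) = 0 → ∀ t, θ (t, x) = x) ∧
        (∀ (x : Literature.Topology.FourManifolds.LefschetzBase.Base g),
          a (Literature.Topology.FourManifolds.LefschetzBase.w g x.1) = 0 → ∀ t, R.toFun t x = x) := by
  intro g a ha
  obtain ⟨θ, hθ, h0, hadd, hder, hfix⟩ := exists_rotFlow_fix g ha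
  have hrho : ∀ t x, rho g (θ (t, x)) = rho g x := fun t x => by
    have h := rho_flowline_eq (hder x) t
    rwa [h0] at h
  exact ⟨baseIsotopy hrho h0 hadd hθ, θ, hθ, h0, hadd, fun t x => rfl, hder, hrho, hfix,
    fun x hx t => Subtype.ext (hfix x.1 hx t)⟩

end Summit.SmoothPoincare4.SmoothPoincare4.Theorems.AcyclicBisectionExists.ModpBraidOrbits
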